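import Summits.CriticalPhenomena.CardyFormulaZ2.Theorems.CardyTensorRGPolyominoGaussianLawStubDilationEquicontinuityPart3
import Literature.Probability.Percolation.PlanarDuality
import HarnessLib

/-!
# Crux `ClusterSetConnected`, line `registered` — stub `stub_walkExtraction`

Stub S1a-W of the skeleton `Cruxes/ClusterSetConnected/Lines/registered.lean` (crux
stmt-CriticalPhenomena-5769, routes `CardyAnchoredRigidity` / `CardyLocalRigidity`): a compact
connected set `K` lying in the drawn open edges `openEdgeUnion δ ω` of `δℤ²` (`δ > 0`) is shadowed
by an OPEN LATTICE CHAIN between any two of its points — sites `f 0 ∼ f 1 ∼ ⋯ ∼ f (n+1)` with open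
lattice edges, every site within `δ` of `K`, the first drawn edge containing `a` and the last
containing `b` (Schramm–Smirnov 2011, §1.3: "in the discrete setting there is no difference between
connected and path-connected crossings").

Proof: the tree's `openConnIn_of_isPreconnected_subset_openEdgeUnion` (imported through the
`PolyominoGaussianLaw` sandwich file, whose `dl_openEdgeUnion_inter_edgeSet` is reused) joins the ends of the open
edges drawn through `a` and through `b` (`exists_mem_edgePairs_of_mem`) by an open lattice path
through the set `S` of sites within `δ` of `K`; `exists_walk_of_mem_openConnIn` turns it into a walk
(for the lattice part `ω ∩ E(ℤ²)` of the configuration, which draws the same open edges), which is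
transferred to the graph `ℤ² ⊓ openGraph ω`, extended by the two end edges and read off through
`SimpleGraph.Walk.getVert`.
-/

noncomputable section

open Set Metric
open Literature.Probability.Percolation Literature.Probability.LatticeModels

namespace Summit.CriticalPhenomena.CardyFormulaZ2.Theorems.ClusterSetConnected

/-- An end of an open edge drawn through `K` (mesh `δ > 0`) is within `δ` of `K`. -/
theorem infDist_le_of_mem_edgePairs {δ : ℝ} (hδ : 0 < δ) {ω : BondConfig (Site 2)} {K : Set ℂ}
    {p : Site 2 × Site 2} (hp : p ∈ edgePairs δ ω K) : infDist (meshPoint δ p.1) K ≤ δ := by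
  obtain ⟨z, hzs, hzK⟩ := hp.2.2
  exact (infDist_le_dist_of_mem hzK).trans (dist_meshPoint_le_of_mem_segment hδ hp.1 hzs)

/-- **stub_walkExtraction** (S1a-W). A compact connected `K ⊆ openEdgeUnion δ ω` (`δ > 0`) is
shadowed by an open lattice chain: for `a, b ∈ K` there are sites `f 0, …, f (n+1)` with
`f j ∼ f (j+1)` an OPEN edge of `ℤ²` for `j ≤ n`, every `f j` within `δ` of `K`, `a` on the drawn
edge `[δ f 0, δ f 1]` and `b` on `[δ f n, δ f (n+1)]`. -/
theorem stub_walkExtraction :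
    ∀ (δ : ℝ), 0 < δ → ∀ (ω : Literature.Probability.Percolation.BondConfig (Literature.Probability.LatticeModels.Site 2))
      (K : Set ℂ), IsCompact K → IsConnected K →
      K ⊆ Literature.Probability.Percolation.openEdgeUnion δ ω → ∀ a ∈ K, ∀ b ∈ K,
        ∃ (n : ℕ) (f : ℕ → Literature.Probability.LatticeModels.Site 2),
          a ∈ segment ℝ (Literature.Probability.LatticeModels.meshPoint δ (f 0))
              (Literature.Probability.LatticeModels.meshPoint δ (f 1)) ∧
          b ∈ segment ℝ (Literature.Probability.LatticeModels.meshPoint δ (f n))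
              (Literature.Probability.LatticeModels.meshPoint δ (f (n + 1))) ∧
          (∀ j ≤ n, (Literature.Probability.LatticeModels.zdGraph 2).Adj (f j) (f (j + 1)) ∧
            s(f j, f (j + 1)) ∈ ω) ∧
          ∀ j ≤ n + 1, Metric.infDist (Literature.Probability.LatticeModels.meshPoint δ (f j)) K ≤ δ := by
  intro δ hδ ω K hKc hK hKO a ha b hb
  -- work with the lattice part `ω ∩ E(ℤ²)` of the configuration (it draws the same open edges)
  have hω'E : ω ∩ (zdGraph 2).edgeSet ⊆ (zdGraph 2).edgeSet := inter_subset_right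
  have hKO' : K ⊆ openEdgeUnion δ (ω ∩ (zdGraph 2).edgeSet) := by
    rw [Summit.CriticalPhenomena.CardyFormulaZ2.Cruxes.PolyominoGaussianLaw.Birth.dl_openEdgeUnion_inter_edgeSet]
    exact hKO
  -- the open edges drawn through `a` and through `b`
  obtain ⟨p, hp, hap⟩ := exists_mem_edgePairs_of_mem hKO' ha
  obtain ⟨p', hp', hbp'⟩ := exists_mem_edgePairs_of_mem hKO' hb
  -- (types `infDist (meshPoint δ p.swap.1) K ≤ δ`, used at `p.2` by `exact`, the cheap direction)
  have hp2 := infDist_le_of_mem_edgePairs hδ (swap_mem_edgePairs hp)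
  have hp'2 := infDist_le_of_mem_edgePairs hδ (swap_mem_edgePairs hp')
  -- the sites within `δ` of `K` contain every end of an open edge drawn through `K`
  have hSp : ∀ q ∈ edgePairs δ (ω ∩ (zdGraph 2).edgeSet) K,
      q.1 ∈ {v : Site 2 | infDist (meshPoint δ v) K ≤ δ} :=
    fun q hq => infDist_le_of_mem_edgePairs hδ hq
  -- an open lattice walk from `p.1` to `p'.1` through those sites
  have hconn : ω ∩ (zdGraph 2).edgeSet ∈
      openConnIn {v : Site 2 | infDist (meshPoint δ v) K ≤ δ} p.1 p'.1 :=
    openConnIn_of_isPreconnected_subset_openEdgeUnion hδ hKc hK.isPreconnected hKO' hSp hp hp'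
  obtain ⟨W₀, hW₀S, hW₀ω⟩ := exists_walk_of_mem_openConnIn (G := zdGraph 2) hω'E hconn
  -- transfer it to the graph `ℤ² ⊓ openGraph ω`, whose adjacency is "open lattice edge"
  have hHadj : ∀ {x y : Site 2}, (zdGraph 2 ⊓ openGraph ω).Adj x y ↔
      (zdGraph 2).Adj x y ∧ s(x, y) ∈ ω := by
    intro x y
    rw [SimpleGraph.inf_adj, openGraph_adj]
    exact ⟨fun h => ⟨h.1, h.2.1⟩, fun h => ⟨h.1, h.2, h.1.ne⟩⟩
  have hW₀H : ∀ e ∈ W₀.edges, e ∈ (zdGraph 2 ⊓ openGraph ω).edgeSet := by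
    intro e he
    have hE := W₀.edges_subset_edgeSet he
    have hω := (hW₀ω e he).1
    revert hE hω
    induction e using Sym2.ind with
    | h x y =>
      intro hE hω
      rw [SimpleGraph.mem_edgeSet] at hE ⊢
      exact hHadj.2 ⟨hE, hω⟩
  have hW₁S : ∀ z ∈ (W₀.transfer _ hW₀H).support, infDist (meshPoint δ z) K ≤ δ := by
    rw [SimpleGraph.Walk.support_transfer]; exact hW₀S
  -- extend by the two end edges and read the chain off with `getVert`
  have h₁ : (zdGraph 2 ⊓ openGraph ω).Adj p.2 p.1 :=
    hHadj.2 ⟨hp.1.symm, by rw [Sym2.eq_swap]; exact hp.2.1.1⟩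
  have h₂ : (zdGraph 2 ⊓ openGraph ω).Adj p'.1 p'.2 := hHadj.2 ⟨hp'.1, hp'.2.1.1⟩
  have hlen : ((W₀.transfer _ hW₀H).concat h₂).length = W₀.length + 1 := by
    rw [SimpleGraph.Walk.length_concat, SimpleGraph.Walk.length_transfer]
  refine ⟨W₀.length + 1, (SimpleGraph.Walk.cons h₁ ((W₀.transfer _ hW₀H).concat h₂)).getVert,
    ?_, ?_, ?_, ?_⟩
  · -- `a` on the first edge `[δ p.2, δ p.1]`
    rw [SimpleGraph.Walk.getVert_zero, SimpleGraph.Walk.getVert_cons_succ,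
      SimpleGraph.Walk.getVert_zero, segment_symm]
    exact hap
  · -- `b` on the last edge `[δ p'.1, δ p'.2]`
    have hn : ((W₀.transfer _ hW₀H).concat h₂).getVert W₀.length = p'.1 := by
      rw [SimpleGraph.Walk.concat_eq_append, SimpleGraph.Walk.getVert_append,
        SimpleGraph.Walk.length_transfer, if_neg (lt_irrefl _), Nat.sub_self,
        SimpleGraph.Walk.getVert_zero]
    have hn1 : ((W₀.transfer _ hW₀H).concat h₂).getVert (W₀.length + 1) = p'.2 :=
      SimpleGraph.Walk.getVert_of_length_le _ hlen.le
    rw [SimpleGraph.Walk.getVert_cons_succ, SimpleGraph.Walk.getVert_cons_succ, hn, hn1]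
    exact hbp'
  · -- consecutive sites are joined by open lattice edges
    intro j hj
    have hjlt : j < (SimpleGraph.Walk.cons h₁ ((W₀.transfer _ hW₀H).concat h₂)).length := by
      rw [SimpleGraph.Walk.length_cons, hlen]; omega
    exact hHadj.1 (SimpleGraph.Walk.adj_getVert_succ _ hjlt)
  · -- every site is within `δ` of `K`
    have hsupp : ∀ v ∈ (SimpleGraph.Walk.cons h₁ ((W₀.transfer _ hW₀H).concat h₂)).support,
        infDist (meshPoint δ v) K ≤ δ := by
      intro v hv
      rw [SimpleGraph.Walk.support_cons, List.mem_cons, SimpleGraph.Walk.support_concat,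
        List.mem_append, List.mem_singleton] at hv
      rcases hv with rfl | hv | rfl
      · exact hp2
      · exact hW₁S v hv
      · exact hp'2
    intro j _
    exact hsupp _ (SimpleGraph.Walk.getVert_mem_support _ j)

end Summit.CriticalPhenomena.CardyFormulaZ2.Theorems.ClusterSetConnected

end
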